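import Literature.Geometry.Lorentzian.FinalState
import Literature.Geometry.Lorentzian.InitialDataHomothety
import Literature.Geometry.Lorentzian.LeviCivitaProofs
import Literature.Geometry.Lorentzian.SpacetimeConstSmul
import HarnessLib

/-!
# Route PhotonSphereChannels · crux `TameCensorship` (stmt-FinalStateConjecture-17431) · line `Sketch`, skeleton v7 ·
# stub `stub_timeReverse_admissible`: time reversal `(h, k) ↦ (h, −k)` preserves Christodoulou's admissible class

Helper file (`--supports stmt-FinalStateConjecture-17431`) of line `Sketch` (lead c3, 2026-08-17). The v7 skeleton
halves the robust form of clause (i) of K3 ("no extremal-Kerr late chart in any MGHD") into its future-going half at the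
datum and at the TIME-REVERSED datum `D' = (h, −k)`; for this the reversed datum must again lie in the admissible class
`admissibleVacuumData X` (`FinalState.lean`). This file proves it:

* the Hamiltonian constraint function `R(h) − |k|²_h + (tr_h k)²` is EVEN in `k` and the momentum constraint covector
  `div_h k − d(tr_h k)` is LINEAR in `k` (`KSmul.hamiltonianConstraintFn_eq`, `KSmul.momentumConstraintFn_eq`, for the
  general substitution `k ↦ b k` with `h` fixed: `|bk|² = b²|k|²`, `tr (bk) = b tr k`, `div (bk) = b div k`,
  `d(b f) = b df`), so `(h, −k)` solves the vacuum constraints iff `(h, k)` does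
  (`KSmul.isVacuumConstraintSolution_iff`, Bartnik–Isenberg 2004, §2);
* completeness sees only `h` (`KSmul.isComplete_iff`);
* in the chart of an asymptotically flat end the metric coefficients are unchanged and the `k` coefficients negate
  (`KSmul.hCoeff_eq`, `KSmul.kCoeff_eq`), so the Dafermos–Rodnianski decay `h = (1 + 2M/r)δ + o₂(r⁻¹)`,
  `k = o₁(r⁻²)` holds for `(h, −k)` on the SAME end with the SAME mass (`KSmul.isStronglyAsymptoticallyFlatDR_neg`);
* whence `stub_timeReverse_admissible`.

Pattern adapted from `Literature/Geometry/Lorentzian/InitialDataHomothety.lean` (`(h, k) ↦ (c²h, ck)`) and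
`AFEndDilationDecay.lean` (`dilate_mem_admissibleVacuumData`); the Levi-Civita-dependent quantities of `D'` and `D` are
compared through `D'.metric = D.metric` by substitution (the instance `[g.HasLeviCivita]` is a proposition).

References: R. Bartnik, J. Isenberg, *The constraint equations* (2004), §2; D. Christodoulou, CQG 16 (1999) A23, p. A24;
M. Dafermos, I. Rodnianski, Clay lectures (2013), App. B.2.3.
-/

set_option linter.dupNamespace false

-- instance search through the nested operator type `E →L[ℝ] E →L[ℝ] ℝ` (as in `InitialDataHomothety`)
set_option maxSynthPendingDepth 3

open Literature.Geometry.Lorentzian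
open scoped Manifold ContDiff Topology
open Filter Set Function Bundle Asymptotics Bornology

noncomputable section

namespace Summit.FinalStateConjecture.FinalStateConjecture.Theorems.PhotonSphereChannels.TameCensorshipUnwind

namespace KSmul

/-! ### `k ↦ b • k` with `h` fixed: the constraint functions -/

section General

variable {E : Type*} [NormedAddCommGroup E] [NormedSpace ℝ E] {H : Type*} [TopologicalSpace H]
  {I : ModelWithCorners ℝ E H} {X : Type*} [TopologicalSpace X] [ChartedSpace H X]
  [IsManifold I ∞ X]

/-- **`div_g (b k) = b div_g k`** at a point where the field of bilinear forms `k` is differentiable (`∇(bk) = b∇k`,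
`covDeriv₂_const_smul`, and linearity of the metric contraction). O'Neill 1983, Ch. 3, p. 86. [folklore] -/
theorem divergence_const_smul [FiniteDimensional ℝ E]
    (g : PseudoRiemannianMetric I ∞ E (TangentSpace I : X → Type _)) [g.HasLeviCivita] (b : ℝ)
    {k : Π x : X, TangentSpace I x →L[ℝ] TangentSpace I x →L[ℝ] ℝ} {x : X}
    (hk : MDifferentiableAt I (I.prod 𝓘(ℝ, E →L[ℝ] E →L[ℝ] ℝ))
      (fun y ↦ TotalSpace.mk' (E →L[ℝ] E →L[ℝ] ℝ)
        (E := fun y : X ↦ TangentSpace I y →L[ℝ] TangentSpace I y →L[ℝ] ℝ) y (k y)) x)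
    (V₀ : TangentSpace I x) :
    g.divergence (fun y ↦ b • k y) x V₀ = b * g.divergence k x V₀ := by
  have haux : g.divergenceAux (fun y ↦ b • k y) x V₀ = b • g.divergenceAux k x V₀ := by
    refine LinearMap.ext₂ fun U₀ W₀ ↦ ?_
    rw [PseudoRiemannianMetric.divergenceAux_apply, LinearMap.smul_apply, LinearMap.smul_apply,
      PseudoRiemannianMetric.divergenceAux_apply, g.covDeriv₂_const_smul b hk]
    rfl
  rw [PseudoRiemannianMetric.divergence_apply, PseudoRiemannianMetric.divergence_apply, haux,
    PseudoRiemannianMetric.trace_smul]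

variable (D D' : InitialDataSet I X) {b : ℝ}

/-- Data sets with the same metric `h` have the same `PseudoRiemannianMetric`. [folklore] -/
theorem metric_eq (hh : D'.h = D.h) : D'.metric = D.metric := by
  unfold InitialDataSet.metric
  rw [hh]

/-- If `k' = b k` pointwise then `kBilin' = b • kBilin`. [folklore] -/
theorem kBilin_eq (hk : ∀ x, D'.k x = b • D.k x) (x : X) : D'.kBilin x = b • D.kBilin x := by
  refine LinearMap.ext₂ fun v w ↦ ?_
  rw [LinearMap.smul_apply, LinearMap.smul_apply, InitialDataSet.kBilin_apply,
    InitialDataSet.kBilin_apply, hk x]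
  rfl

variable [FiniteDimensional ℝ E]

/-- **Mean curvature is linear in `k`**: `tr_h (b k) = b tr_h k`. Bartnik–Isenberg 2004, §2.
[cite: BartnikIsenberg2004, §2] -/
theorem traceK_eq (hh : D'.h = D.h) (hk : ∀ x, D'.k x = b • D.k x) (x : X) :
    D'.traceK x = b * D.traceK x := by
  rw [InitialDataSet.traceK, InitialDataSet.traceK, kBilin_eq D D' hk, metric_eq D D' hh,
    PseudoRiemannianMetric.trace_smul]

/-- `tr_h (b k) = b tr_h k` as functions. [cite: BartnikIsenberg2004, §2] -/
theorem traceK_fun_eq (hh : D'.h = D.h) (hk : ∀ x, D'.k x = b • D.k x) :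
    D'.traceK = fun x ↦ b * D.traceK x :=
  funext (traceK_eq D D' hh hk)

/-- **The square norm is quadratic in `k`**: `|b k|²_h = b² |k|²_h`. Bartnik–Isenberg 2004, §2.
[cite: BartnikIsenberg2004, §2] -/
theorem normSqK_eq (hh : D'.h = D.h) (hk : ∀ x, D'.k x = b • D.k x) (x : X) :
    D'.normSqK x = b ^ 2 * D.normSqK x := by
  rw [InitialDataSet.normSqK, InitialDataSet.normSqK, kBilin_eq D D' hk, metric_eq D D' hh]
  have hflip : (b • D.kBilin x).flip = b • (D.kBilin x).flip := by
    refine LinearMap.ext₂ fun v w ↦ ?_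
    rfl
  simp only [PseudoRiemannianMetric.normSq, hflip, LinearMap.comp_smul, LinearMap.smul_comp,
    smul_smul, LinearMap.map_smul, smul_eq_mul, sq]

section LeviCivita

variable [D.metric.HasLeviCivita] [D'.metric.HasLeviCivita]

omit [FiniteDimensional ℝ E] in
/-- The Levi-Civita connection sees only `h`: `∇^{h'} = ∇^{h}` for `h' = h` (the standing instances
`[D.metric.HasLeviCivita]`, `[D'.metric.HasLeviCivita]` are proofs of one proposition). O'Neill 1983, Ch. 3,
Thm. 3.11. [folklore] -/
theorem leviCivita_eq (hh : D'.h = D.h) : D'.metric.leviCivita = D.metric.leviCivita := by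
  have key : ∀ (g' : PseudoRiemannianMetric I ∞ E (TangentSpace I : X → Type _)) [g'.HasLeviCivita],
      g' = D.metric → g'.leviCivita = D.metric.leviCivita := by
    intro g' _ hg'
    subst hg'
    rfl
  exact key _ (metric_eq D D' hh)

/-- **Completeness sees only `h`.** Bartnik–Isenberg 2004, §2. [cite: BartnikIsenberg2004, §2] -/
theorem isComplete_iff (hh : D'.h = D.h) : D'.IsComplete ↔ D.IsComplete := by
  unfold InitialDataSet.IsComplete
  rw [leviCivita_eq D D' hh]

/-- The scalar curvature sees only `h`. [folklore] -/
theorem scalarCurvature_eq [CompleteSpace E] (hh : D'.h = D.h) (x : X) :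
    D'.metric.scalarCurvature x = D.metric.scalarCurvature x := by
  have key : ∀ (g' : PseudoRiemannianMetric I ∞ E (TangentSpace I : X → Type _)) [g'.HasLeviCivita],
      g' = D.metric → g'.scalarCurvature x = D.metric.scalarCurvature x := by
    intro g' _ hg'
    subst hg'
    rfl
  exact key _ (metric_eq D D' hh)

/-- **The divergence is linear in `k`**: `div_h (b k) = b div_h k`. Bartnik–Isenberg 2004, §2.
[cite: BartnikIsenberg2004, §2] -/
theorem divergence_eq (hh : D'.h = D.h) (hk : ∀ x, D'.k x = b • D.k x) (x : X) (V₀ : TangentSpace I x) :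
    D'.metric.divergence D'.k x V₀ = b * D.metric.divergence D.k x V₀ := by
  have hk' : D'.k = fun y ↦ b • D.k y := funext hk
  have key : ∀ (g' : PseudoRiemannianMetric I ∞ E (TangentSpace I : X → Type _)) [g'.HasLeviCivita],
      g' = D.metric → g'.divergence (fun y ↦ b • D.k y) x V₀ = b * D.metric.divergence D.k x V₀ := by
    intro g' _ hg'
    subst hg'
    exact divergence_const_smul D.metric b (D.mdifferentiableAt_k x) V₀
  rw [hk']
  exact key _ (metric_eq D D' hh)

/-- **The Hamiltonian constraint function under `k ↦ b k`**:
`(R − |k|² + (tr k)²)(h, b k) = R(h) − b² |k|²_h + b² (tr_h k)²`. Bartnik–Isenberg 2004, (2.1).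
[cite: BartnikIsenberg2004, §2] -/
theorem hamiltonianConstraintFn_eq [CompleteSpace E] (hh : D'.h = D.h) (hk : ∀ x, D'.k x = b • D.k x) (x : X) :
    D'.hamiltonianConstraintFn x =
      D.metric.scalarCurvature x - b ^ 2 * D.normSqK x + b ^ 2 * D.traceK x ^ 2 := by
  rw [InitialDataSet.hamiltonianConstraintFn, scalarCurvature_eq D D' hh, normSqK_eq D D' hh hk,
    traceK_eq D D' hh hk]
  ring

/-- **The Hamiltonian constraint function is even in `k`**: for `b² = 1` (i.e. `b = ±1`) it is unchanged.
Bartnik–Isenberg 2004, (2.1). [cite: BartnikIsenberg2004, §2] -/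
theorem hamiltonianConstraintFn_eq_of_sq_eq_one [CompleteSpace E] (hh : D'.h = D.h)
    (hk : ∀ x, D'.k x = b • D.k x) (hb : b ^ 2 = 1) (x : X) :
    D'.hamiltonianConstraintFn x = D.hamiltonianConstraintFn x := by
  rw [hamiltonianConstraintFn_eq D D' hh hk, hb, InitialDataSet.hamiltonianConstraintFn]
  ring

/-- **The momentum constraint covector is linear in `k`**: `(div k − d tr k)(h, b k) = b (div k − d tr k)(h, k)`.
Bartnik–Isenberg 2004, (2.2). [cite: BartnikIsenberg2004, §2] -/
theorem momentumConstraintFn_eq (hh : D'.h = D.h) (hk : ∀ x, D'.k x = b • D.k x) (x : X) :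
    D'.momentumConstraintFn x = b • D.momentumConstraintFn x := by
  refine LinearMap.ext fun V₀ ↦ ?_
  rw [LinearMap.smul_apply, InitialDataSet.momentumConstraintFn_apply,
    InitialDataSet.momentumConstraintFn_apply, divergence_eq D D' hh hk, traceK_fun_eq D D' hh hk]
  change b * D.metric.divergence D.k x V₀ - mvfderiv I (fun y ↦ b * D.traceK y) x V₀ =
    b • (D.metric.divergence D.k x V₀ - mvfderiv I D.traceK x V₀)
  rw [PseudoRiemannianMetric.mvfderiv_const_mul]
  simp only [FunLike.coe_smul, Pi.smul_apply, smul_eq_mul]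
  ring

/-- **The vacuum constraints are invariant under `k ↦ ±k`** (`b² = 1`): the Hamiltonian constraint function is
even and the momentum constraint covector is odd in `k`. Bartnik–Isenberg 2004, (2.1)–(2.2) ("both equations are
insensitive to the sign convention for `k`", `InitialDataSet.IsVacuumConstraintSolution`).
[cite: BartnikIsenberg2004, §2] -/
theorem isVacuumConstraintSolution_iff [CompleteSpace E] (hh : D'.h = D.h) (hk : ∀ x, D'.k x = b • D.k x)
    (hb : b ^ 2 = 1) : D'.IsVacuumConstraintSolution ↔ D.IsVacuumConstraintSolution := by
  have hb0 : b ≠ 0 := by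
    rintro rfl
    norm_num at hb
  refine forall_congr' fun x ↦ ?_
  rw [hamiltonianConstraintFn_eq_of_sq_eq_one D D' hh hk hb, momentumConstraintFn_eq D D' hh hk,
    smul_eq_zero_iff_right hb0]

end LeviCivita

end General

/-! ### `k ↦ b • k` with `h` fixed: the chart coefficients of an asymptotically flat end -/

section End

variable {X : Type*} [TopologicalSpace X] [ChartedSpace E3 X] [IsManifold (𝓡 3) ∞ X]
  (e : AFEnd X) (D D' : InitialDataSet (𝓡 3) X) {b : ℝ}

/-- The metric coefficients in the chart of the end see only `h`. [folklore] -/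
theorem hCoeff_eq (hh : D'.h = D.h) : AFEnd.hCoeff e D' = AFEnd.hCoeff e D := by
  funext x
  unfold AFEnd.hCoeff
  rw [hh]

/-- The `k` coefficients in the chart of the end are linear in `k`: `kCoeff e (h, b k) = b • kCoeff e (h, k)`
(pullback commutes with constant rescaling, `pullbackBilin_const_smul`; the junk value `0` inside the ball is
fixed). [folklore] -/
theorem kCoeff_eq (hk : ∀ x, D'.k x = b • D.k x) (x : E3) :
    AFEnd.kCoeff e D' x = b • AFEnd.kCoeff e D x := by
  unfold AFEnd.kCoeff
  split_ifs with hx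
  · rw [show D'.k = fun y ↦ b • D.k y from funext hk, pullbackBilin_const_smul]
    rfl
  · rw [smul_zero]

/-- For `k' = −k` the `k` coefficients negate: `kCoeff e (h, −k) = −kCoeff e (h, k)`. [folklore] -/
theorem kCoeff_eq_neg (hk : ∀ x, D'.k x = (-1 : ℝ) • D.k x) :
    AFEnd.kCoeff e D' = -AFEnd.kCoeff e D := by
  funext x
  rw [kCoeff_eq e D D' hk, neg_one_smul, Pi.neg_apply]

/-- **The Dafermos–Rodnianski rates are blind to the sign of `k`**: if `(h, k)` is strongly asymptotically flat
with mass `M` on the end `e`, so is `(h, −k)`, on the same end with the same mass (the decay conditions see `k`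
only through `‖D^m k_ij‖`, and `D^m(−k) = −D^m k`). Dafermos–Rodnianski 2013, App. B.2.3.
[cite: DafermosRodnianski2013, App. B.2.3] -/
theorem isStronglyAsymptoticallyFlatDR_neg {M : ℝ} (hh : D'.h = D.h) (hk : ∀ x, D'.k x = (-1 : ℝ) • D.k x)
    (h : e.IsStronglyAsymptoticallyFlatDR D M) : e.IsStronglyAsymptoticallyFlatDR D' M := by
  obtain ⟨hH, hK⟩ := h
  refine ⟨fun m hm ↦ ?_, fun m hm ↦ ?_⟩
  · rw [hCoeff_eq e D D' hh]
    exact hH m hm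
  · rw [kCoeff_eq_neg e D D' hk]
    simp only [iteratedFDeriv_neg, Pi.neg_apply, norm_neg]
    exact hK m hm

end End

end KSmul

/-- **Stub `stub_timeReverse_admissible` of line `Sketch` (skeleton v7) for the crux `PhotonSphereChannels.TameCensorship`
(stmt-FinalStateConjecture-17431): time reversal preserves Christodoulou's admissible class.** If `D' = (h, −k)`
pointwise (`D'.h = D.h`, `D'.k x v w = −D.k x v w`) and `D ∈ admissibleVacuumData X`, then `D' ∈ admissibleVacuumData X`:
the Hamiltonian constraint `R(h) − |k|²_h + (tr_h k)² = 0` is even and the momentum constraint `div_h k − d(tr_h k) = 0`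
is odd-linear in `k` (`KSmul.isVacuumConstraintSolution_iff` with `b = −1`), completeness is geodesic completeness of
`h` alone (`KSmul.isComplete_iff`), and the sole strongly asymptotically flat end of `D` serves for `D'` with the same
mass, the Dafermos–Rodnianski decay seeing `k` only through norms of iterated derivatives of its chart coefficients,
which negate (`KSmul.isStronglyAsymptoticallyFlatDR_neg`). Bartnik–Isenberg 2004, §2; Christodoulou 1999, p. A24;
Dafermos–Rodnianski 2013, App. B.2.3. [cite: BartnikIsenberg2004, §2] -/
theorem stub_timeReverse_admissible :
    ∀ (X : Type) [TopologicalSpace X] [ChartedSpace E3 X] [IsManifold (𝓡 3) ∞ X] [T2Space X]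
    [SecondCountableTopology X] [ConnectedSpace X] (D D' : InitialDataSet (𝓡 3) X),
    D'.h = D.h → (∀ (x : X) (v w : TangentSpace (𝓡 3) x), D'.k x v w = -D.k x v w) →
    D ∈ admissibleVacuumData X → D' ∈ admissibleVacuumData X := by
  intro X _ _ _ _ _ _ D D' hh hk hD
  have hk' : ∀ x, D'.k x = (-1 : ℝ) • D.k x := fun x ↦ by
    ext v w
    rw [hk x v w, smul_apply, smul_apply, smul_eq_mul, neg_one_mul]
  obtain ⟨hvc, e, M, hsole, hSAF⟩ := hD
  refine ⟨fun {_} ↦ ?_, e, M, hsole, KSmul.isStronglyAsymptoticallyFlatDR_neg e D D' hh hk' hSAF⟩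
  haveI : D.metric.HasLeviCivita := D.metric.hasLeviCivita
  obtain ⟨hV, hC⟩ := hvc
  exact ⟨(KSmul.isVacuumConstraintSolution_iff D D' hh hk' (by norm_num)).2 hV,
    (KSmul.isComplete_iff D D' hh).2 hC⟩

end Summit.FinalStateConjecture.FinalStateConjecture.Theorems.PhotonSphereChannels.TameCensorshipUnwind

end
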